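import Summits.FinalStateConjecture.FinalStateConjecture.Theorems.PhotonSphereChannelsWindowedShellChannelsStubConeInfluxRight
import Summits.FinalStateConjecture.FinalStateConjecture.Theorems.PhotonSphereChannelsChannelsResolveTameDevelopmentsRTotalEnergyConservation

/-!
# Crux `WindowedShellChannels` (stmt-FinalStateConjecture-14085), line `Sketch`, stub `stub_coneInflux` —
# part 3: the cone-edge influx law `K(t₁) + B(t₁) ≤ IN(t₁)`

The registered stub `stub_coneInflux` of line `Sketch`, over the Literature vocabulary
`ReggeWheeler.{IsSolution, totalEnergy}` (curried `ψ : ℝ → ℝ → ℝ`, `deriv` of slices).  For `V ≥ 0` of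
class `C¹`, single-peaked at `xp` (`(x − xp)V′(x) ≤ 0`), and a finite-energy global `C²` solution `ψ` of
`ψ_tt − ψ_xx + Vψ = 0`, for every apex time `t₁` the KINETIC influx
`K(t₁) = ∫_{t>t₁} [(ψ_t+ψ_x)²(t, xp+(t−t₁)) + (ψ_t−ψ_x)²(t, xp−(t−t₁))] dt` through the two null edges of the
cone with apex `(t₁, xp)` plus the exterior acceleration bulk `B(t₁) = ½∬_{t>t₁, |x−xp|>t−t₁} |V′|ψ²` is at most
the incoming characteristic energy `IN(t₁) = ½∫_{x>xp}[(ψ_t+ψ_x)² + Vψ²] + ½∫_{x<xp}[(ψ_t−ψ_x)² + Vψ²]`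
(all terms in `[0, ∞]`):

* `ConeInflux.right` — the right half (edge `xp + (t − t₁)`, bulk over `x − xp > t − t₁`, `IN` over `x > xp`):
  part 2's `right_influx_le` through the dictionary `WaveEnergy.deriv_slice_fst_eq/snd_eq`,
  `RW.energyDensity_he`, `RW.IsSolution.fderiv_eq` and energy conservation `RW.totalEnergy_eq_totalEnergy`;
* `ConeInflux.left` — the mirror image, from `right` applied to `V(−·)` (single-peaked at `−xp`) and
  `ψ(·,−·)` (again a finite-energy solution: `deriv_comp_neg`, `iteratedDeriv_comp_neg`, invariance of
  Lebesgue measure under `x ↦ −x` on `ℝ` and `ℝ × ℝ`);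
* `stub_coneInflux` — splitting of the kinetic integrand (`lintegral_add_left`) and of the bulk set
  `{t₁ < t, t − t₁ < |x − xp|}` into its disjoint right and left parts.

The hypothesis `|V′| ≤ K V` of the stub is not needed (the bulk is only integrated over bounded
trapezoids before monotone convergence).  Standard material [folklore].
-/

noncomputable section

set_option linter.dupNamespace false

namespace Summit.FinalStateConjecture.FinalStateConjecture.Theorems.WindowedShellChannelsSketch

open Literature.Geometry.Lorentzian Literature.Geometry.Lorentzian.ReggeWheeler Filter Set MeasureTheory
open scoped ENNReal Topology

namespace ConeInflux

/-! ### Curried vocabulary: the right law, the left law by reflection `x ↦ −x` -/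

section Curried

variable {V V' : ℝ → ℝ} {xp : ℝ} {ψ : ℝ → ℝ → ℝ}

/-- **Right influx law** in the vocabulary of the stub: for `V ≥ 0` of class `C¹`, single-peaked at `xp`
(`(x − xp)V′(x) ≤ 0`), and a finite-energy global `C²` solution `ψ`, for every apex time `t₁`,
`∫⁻_{t>t₁} (ψ_t + ψ_x)²(t, xp + (t − t₁)) + ½∬_{t>t₁, x−xp>t−t₁} |V′|ψ² ≤ ½∫⁻_{x>xp} [(ψ_t + ψ_x)² + Vψ²](t₁,·)`
(`right_influx_le` through the dictionary `WaveEnergy.deriv_slice_fst_eq/snd_eq` and energy conservation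
`RW.totalEnergy_eq_totalEnergy`). -/
theorem right (hV : ∀ x, HasDerivAt V (V' x) x) (hV'c : Continuous V') (hV0 : ∀ x, 0 ≤ V x)
    (hmono : ∀ x, (x - xp) * V' x ≤ 0) (hψ : IsSolution V ψ) (hE : totalEnergy V ψ 0 ≠ ⊤)
    (t₁ : ℝ) :
    (∫⁻ t in Ioi t₁, ENNReal.ofReal
        ((deriv (fun τ => ψ τ (xp + (t - t₁))) t + deriv (ψ t) (xp + (t - t₁))) ^ 2))
      + (∫⁻ z in {z : ℝ × ℝ | t₁ < z.1 ∧ z.1 - t₁ < z.2 - xp},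
          ENNReal.ofReal (2⁻¹ * (|V' z.2| * ψ z.1 z.2 ^ 2)))
    ≤ ∫⁻ x in Ioi xp, ENNReal.ofReal
        (2⁻¹ * ((deriv (fun τ => ψ τ x) t₁ + deriv (ψ t₁) x) ^ 2 + V x * ψ t₁ x ^ 2)) := by
  have hVd : Differentiable ℝ V := fun x => (hV x).differentiableAt
  have hV'R : ∀ x, xp < x → V' x ≤ 0 := fun x hx => by
    by_contra h
    exact absurd (hmono x) (not_le.2 (mul_pos (sub_pos.2 hx) (not_le.1 h)))
  have he := RW.energyDensity_he (V := V) hψ.1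
  have hsol := RW.IsSolution.fderiv_eq hψ
  have hcons : ∀ t, ∫⁻ x, ENNReal.ofReal ((fun z : ℝ × ℝ => energyDensity V ψ z.1 z.2) (t, x))
      = totalEnergy V ψ 0 := fun t => RW.totalEnergy_eq_totalEnergy hVd hV0 hψ t 0
  have h1 : ∀ t, ENNReal.ofReal ((deriv (fun τ => ψ τ (xp + (t - t₁))) t
      + deriv (ψ t) (xp + (t - t₁))) ^ 2)
      = ENNReal.ofReal ((fderiv ℝ (Function.uncurry ψ) (t, xp + (t - t₁)) (1, 0)
        + fderiv ℝ (Function.uncurry ψ) (t, xp + (t - t₁)) (0, 1)) ^ 2) := fun t => by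
    rw [WaveEnergy.deriv_slice_fst_eq hψ.1, WaveEnergy.deriv_slice_snd_eq hψ.1]
  have h3 : ∀ x, ENNReal.ofReal (2⁻¹ * ((deriv (fun τ => ψ τ x) t₁ + deriv (ψ t₁) x) ^ 2
      + V x * ψ t₁ x ^ 2))
      = ENNReal.ofReal (2⁻¹ * ((fderiv ℝ (Function.uncurry ψ) (t₁, x) (1, 0)
        + fderiv ℝ (Function.uncurry ψ) (t₁, x) (0, 1)) ^ 2
        + V x * Function.uncurry ψ (t₁, x) ^ 2)) := fun x => by
    rw [WaveEnergy.deriv_slice_fst_eq hψ.1, WaveEnergy.deriv_slice_snd_eq hψ.1]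
    rfl
  simp_rw [h1, h3]
  exact right_influx_le hψ.1 hV hV'c hV0 hsol hV'R he hE hcons t₁

/-- **Left influx law**, the mirror image of `right` under `x ↦ −x` (`V(−·)` is single-peaked at `−xp`
and `ψ(·,−·)` is again a finite-energy solution; `deriv_comp_neg`, `iteratedDeriv_comp_neg`, and the
invariance of Lebesgue measure under `x ↦ −x`):
`∫⁻_{t>t₁} (ψ_t − ψ_x)²(t, xp − (t − t₁)) + ½∬_{t>t₁, xp−x>t−t₁} |V′|ψ² ≤ ½∫⁻_{x<xp} [(ψ_t − ψ_x)² + Vψ²](t₁,·)`. -/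
theorem left (hV : ∀ x, HasDerivAt V (V' x) x) (hV'c : Continuous V') (hV0 : ∀ x, 0 ≤ V x)
    (hmono : ∀ x, (x - xp) * V' x ≤ 0) (hψ : IsSolution V ψ) (hE : totalEnergy V ψ 0 ≠ ⊤)
    (t₁ : ℝ) :
    (∫⁻ t in Ioi t₁, ENNReal.ofReal
        ((deriv (fun τ => ψ τ (xp - (t - t₁))) t - deriv (ψ t) (xp - (t - t₁))) ^ 2))
      + (∫⁻ z in {z : ℝ × ℝ | t₁ < z.1 ∧ z.1 - t₁ < -(z.2 - xp)},
          ENNReal.ofReal (2⁻¹ * (|V' z.2| * ψ z.1 z.2 ^ 2)))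
    ≤ ∫⁻ x in Iio xp, ENNReal.ofReal
        (2⁻¹ * ((deriv (fun τ => ψ τ x) t₁ - deriv (ψ t₁) x) ^ 2 + V x * ψ t₁ x ^ 2)) := by
  -- the reflected data
  have hVr : ∀ x, HasDerivAt (fun y => V (-y)) (-V' (-x)) x := fun x => by
    have h := (hV (-x)).comp x (hasDerivAt_neg x)
    rw [mul_neg_one] at h
    exact h
  have hV'rc : Continuous fun y => -V' (-y) := (hV'c.comp continuous_neg).neg
  have hV0r : ∀ x, 0 ≤ V (-x) := fun x => hV0 _
  have hmonor : ∀ x, (x - -xp) * -V' (-x) ≤ 0 := fun x => by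
    have h := hmono (-x)
    have : (x - -xp) * -V' (-x) = (-x - xp) * V' (-x) := by ring
    linarith
  have hψr : IsSolution (fun y => V (-y)) (fun t y => ψ t (-y)) := by
    refine ⟨?_, fun z => ?_⟩
    · have h : Function.uncurry (fun t y => ψ t (-y))
          = Function.uncurry ψ ∘ fun z : ℝ × ℝ => (z.1, -z.2) := by
        funext z
        rfl
      rw [h]
      exact hψ.1.comp (by fun_prop)
    · have h := hψ.2 (z.1, -z.2)
      unfold IsSolutionAt at h ⊢
      simp only at h ⊢
      rw [iteratedDeriv_comp_neg 2 (ψ z.1) z.2, neg_one_sq, one_smul]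
      exact h
  have hEr : totalEnergy (fun y => V (-y)) (fun t y => ψ t (-y)) 0 = totalEnergy V ψ 0 := by
    unfold totalEnergy
    have h2 : ∀ x, ENNReal.ofReal (energyDensity (fun y => V (-y)) (fun t y => ψ t (-y)) 0 x)
        = ENNReal.ofReal (energyDensity V ψ 0 (-x)) := fun x => by
      simp only [energyDensity, deriv_comp_neg (ψ 0), neg_sq]
    simp_rw [h2]
    exact (Measure.measurePreserving_neg (volume : Measure ℝ)).lintegral_comp_emb
      (Homeomorph.neg ℝ).measurableEmbedding (fun y => ENNReal.ofReal (energyDensity V ψ 0 y))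
  have key : (∫⁻ t in Ioi t₁, ENNReal.ofReal
        ((deriv (fun τ => ψ τ (-(-xp + (t - t₁)))) t
          + deriv (fun y => ψ t (-y)) (-xp + (t - t₁))) ^ 2))
      + (∫⁻ z in {z : ℝ × ℝ | t₁ < z.1 ∧ z.1 - t₁ < z.2 - -xp},
          ENNReal.ofReal (2⁻¹ * (|-V' (-z.2)| * ψ z.1 (-z.2) ^ 2)))
      ≤ ∫⁻ x in Ioi (-xp), ENNReal.ofReal
        (2⁻¹ * ((deriv (fun τ => ψ τ (-x)) t₁ + deriv (fun y => ψ t₁ (-y)) x) ^ 2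
          + V (-x) * ψ t₁ (-x) ^ 2)) :=
    right hVr hV'rc hV0r hmonor hψr (by rw [hEr]; exact hE) t₁
  -- undo the reflection in the three terms
  have hK : ∀ t, ENNReal.ofReal ((deriv (fun τ => ψ τ (-(-xp + (t - t₁)))) t
      + deriv (fun y => ψ t (-y)) (-xp + (t - t₁))) ^ 2)
      = ENNReal.ofReal ((deriv (fun τ => ψ τ (xp - (t - t₁))) t
        - deriv (ψ t) (xp - (t - t₁))) ^ 2) := fun t => by
    rw [deriv_comp_neg (ψ t), show -(-xp + (t - t₁)) = xp - (t - t₁) by ring, ← sub_eq_add_neg]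
  have hB : (∫⁻ z in {z : ℝ × ℝ | t₁ < z.1 ∧ z.1 - t₁ < z.2 - -xp},
      ENNReal.ofReal (2⁻¹ * (|-V' (-z.2)| * ψ z.1 (-z.2) ^ 2)))
      = ∫⁻ z in {z : ℝ × ℝ | t₁ < z.1 ∧ z.1 - t₁ < -(z.2 - xp)},
          ENNReal.ofReal (2⁻¹ * (|V' z.2| * ψ z.1 z.2 ^ 2)) := by
    have hr_eq : (fun z : ℝ × ℝ => (z.1, -z.2)) = Prod.map id Neg.neg := funext fun ⟨a, b⟩ => rfl
    have hr : MeasurePreserving (fun z : ℝ × ℝ => (z.1, -z.2)) volume volume := by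
      rw [hr_eq]
      exact (MeasurePreserving.id volume).prod (Measure.measurePreserving_neg volume)
    have hre : MeasurableEmbedding (fun z : ℝ × ℝ => (z.1, -z.2)) := by
      rw [hr_eq]
      exact ((MeasurableEquiv.refl ℝ).prodCongr (MeasurableEquiv.neg ℝ)).measurableEmbedding
    have hset : {z : ℝ × ℝ | t₁ < z.1 ∧ z.1 - t₁ < z.2 - -xp}
        = (fun z : ℝ × ℝ => (z.1, -z.2)) ⁻¹' {z : ℝ × ℝ | t₁ < z.1 ∧ z.1 - t₁ < -(z.2 - xp)} := by
      ext z
      simp only [mem_setOf_eq, mem_preimage]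
      constructor <;> rintro ⟨h1, h2⟩ <;> exact ⟨h1, by linarith⟩
    rw [hset]
    simp_rw [abs_neg]
    exact hr.setLIntegral_comp_preimage_emb hre
      (fun w : ℝ × ℝ => ENNReal.ofReal (2⁻¹ * (|V' w.2| * ψ w.1 w.2 ^ 2))) _
  have hI : (∫⁻ x in Ioi (-xp), ENNReal.ofReal
        (2⁻¹ * ((deriv (fun τ => ψ τ (-x)) t₁ + deriv (fun y => ψ t₁ (-y)) x) ^ 2
          + V (-x) * ψ t₁ (-x) ^ 2)))
      = ∫⁻ x in Iio xp, ENNReal.ofReal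
        (2⁻¹ * ((deriv (fun τ => ψ τ x) t₁ - deriv (ψ t₁) x) ^ 2 + V x * ψ t₁ x ^ 2)) := by
    have hset : Ioi (-xp) = Neg.neg ⁻¹' Iio xp := by
      ext x
      simp only [mem_Ioi, mem_preimage, mem_Iio]
      constructor <;> intro h <;> linarith
    have h2 : ∀ x, ENNReal.ofReal (2⁻¹ * ((deriv (fun τ => ψ τ (-x)) t₁
        + deriv (fun y => ψ t₁ (-y)) x) ^ 2 + V (-x) * ψ t₁ (-x) ^ 2))
        = ENNReal.ofReal (2⁻¹ * ((deriv (fun τ => ψ τ (-x)) t₁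
          - deriv (ψ t₁) (-x)) ^ 2 + V (-x) * ψ t₁ (-x) ^ 2)) := fun x => by
      rw [deriv_comp_neg (ψ t₁), ← sub_eq_add_neg]
    rw [hset]
    simp_rw [h2]
    exact (Measure.measurePreserving_neg (volume : Measure ℝ)).setLIntegral_comp_preimage_emb
      (Homeomorph.neg ℝ).measurableEmbedding
      (fun y => ENNReal.ofReal (2⁻¹ * ((deriv (fun τ => ψ τ y) t₁ - deriv (ψ t₁) y) ^ 2
        + V y * ψ t₁ y ^ 2))) (Iio xp)
  simp_rw [hK] at key
  rwa [hB, hI] at key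

end Curried

end ConeInflux

/-- **Cone-edge influx law** (registered stub `stub_coneInflux` of line `Sketch`, crux
stmt-FinalStateConjecture-14085).  For `V ≥ 0` of class `C¹` with `|V′| ≤ K V`, single-peaked at `xp`
(`(x − xp)V′(x) ≤ 0`), a finite-energy global `C²` solution `ψ` of `ψ_tt − ψ_xx + Vψ = 0` and any apex time
`t₁`: the KINETIC influx `∫_{t>t₁}[(ψ_t+ψ_x)²(t, xp+(t−t₁)) + (ψ_t−ψ_x)²(t, xp−(t−t₁))]dt` through the two null
edges of the cone with apex `(t₁, xp)` plus the exterior acceleration bulk `½∬_{t>t₁, |x−xp|>t−t₁} |V′|ψ²`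
is at most the incoming characteristic energy
`IN(t₁) = ½∫_{x>xp}[(ψ_t+ψ_x)² + Vψ²] + ½∫_{x<xp}[(ψ_t−ψ_x)² + Vψ²]` at the apex time.  Proof: the transport
law `∂ₜε − ∂ₓj = V′ψ²` of `ε = (ψ_t+ψ_x)² + Vψ²`, `j = (ψ_t+ψ_x)² − Vψ²` on the right exterior trapezoids
(`ConeInflux.right`), its mirror image on the left (`ConeInflux.left`), and the splitting of the kinetic
term and of the bulk set into their right and left parts. -/
theorem stub_coneInflux (V V' : ℝ → ℝ) (K xp : ℝ) (hV : ∀ x, HasDerivAt V (V' x) x) (hV'c : Continuous V')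
    (hV0 : ∀ x, 0 ≤ V x) (hK : ∀ x, |V' x| ≤ K * V x) (hmono : ∀ x, (x - xp) * V' x ≤ 0)
    (ψ : ℝ → ℝ → ℝ) (hψ : IsSolution V ψ) (hE : totalEnergy V ψ 0 ≠ ⊤) (t₁ : ℝ) :
    (∫⁻ t in Ioi t₁, ENNReal.ofReal
        ((deriv (fun τ => ψ τ (xp + (t - t₁))) t + deriv (ψ t) (xp + (t - t₁))) ^ 2
          + (deriv (fun τ => ψ τ (xp - (t - t₁))) t - deriv (ψ t) (xp - (t - t₁))) ^ 2))
      + (∫⁻ z in {z : ℝ × ℝ | t₁ < z.1 ∧ z.1 - t₁ < |z.2 - xp|},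
          ENNReal.ofReal (2⁻¹ * (|V' z.2| * ψ z.1 z.2 ^ 2)))
    ≤ (∫⁻ x in Ioi xp, ENNReal.ofReal
        (2⁻¹ * ((deriv (fun τ => ψ τ x) t₁ + deriv (ψ t₁) x) ^ 2 + V x * ψ t₁ x ^ 2)))
      + (∫⁻ x in Iio xp, ENNReal.ofReal
        (2⁻¹ * ((deriv (fun τ => ψ τ x) t₁ - deriv (ψ t₁) x) ^ 2 + V x * ψ t₁ x ^ 2))) := by
  have _ := hK -- `|V′| ≤ K V` is not needed: the bulk is only ever integrated over bounded trapezoids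
  have hR := ConeInflux.right hV hV'c hV0 hmono hψ hE t₁
  have hL := ConeInflux.left hV hV'c hV0 hmono hψ hE t₁
  -- split the kinetic influx into its right and left parts
  have hmeas : Measurable fun t => ENNReal.ofReal
      ((deriv (fun τ => ψ τ (xp + (t - t₁))) t + deriv (ψ t) (xp + (t - t₁))) ^ 2) := by
    have h : (fun t => (deriv (fun τ => ψ τ (xp + (t - t₁))) t + deriv (ψ t) (xp + (t - t₁))) ^ 2)
        = fun t => (fderiv ℝ (Function.uncurry ψ) (t, xp + (t - t₁)) (1, 0)
          + fderiv ℝ (Function.uncurry ψ) (t, xp + (t - t₁)) (0, 1)) ^ 2 :=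
      funext fun t => by rw [WaveEnergy.deriv_slice_fst_eq hψ.1, WaveEnergy.deriv_slice_snd_eq hψ.1]
    refine ENNReal.measurable_ofReal.comp ?_
    rw [h]
    have h1 := WaveEnergy.continuous_fderiv_apply hψ.1 (1, 0)
    have h2 := WaveEnergy.continuous_fderiv_apply hψ.1 (0, 1)
    have hγ : Continuous fun t : ℝ => ((t, xp + (t - t₁)) : ℝ × ℝ) := by fun_prop
    exact (((h1.comp hγ).add (h2.comp hγ)).pow 2).measurable
  have hKsplit : (∫⁻ t in Ioi t₁, ENNReal.ofReal
      ((deriv (fun τ => ψ τ (xp + (t - t₁))) t + deriv (ψ t) (xp + (t - t₁))) ^ 2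
        + (deriv (fun τ => ψ τ (xp - (t - t₁))) t - deriv (ψ t) (xp - (t - t₁))) ^ 2))
      = (∫⁻ t in Ioi t₁, ENNReal.ofReal
          ((deriv (fun τ => ψ τ (xp + (t - t₁))) t + deriv (ψ t) (xp + (t - t₁))) ^ 2))
        + ∫⁻ t in Ioi t₁, ENNReal.ofReal
          ((deriv (fun τ => ψ τ (xp - (t - t₁))) t - deriv (ψ t) (xp - (t - t₁))) ^ 2) := by
    rw [← lintegral_add_left hmeas]
    exact lintegral_congr fun t => ENNReal.ofReal_add (sq_nonneg _) (sq_nonneg _)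
  -- split the bulk set into its right and left parts
  have hBsplit : (∫⁻ z in {z : ℝ × ℝ | t₁ < z.1 ∧ z.1 - t₁ < |z.2 - xp|},
      ENNReal.ofReal (2⁻¹ * (|V' z.2| * ψ z.1 z.2 ^ 2)))
      = (∫⁻ z in {z : ℝ × ℝ | t₁ < z.1 ∧ z.1 - t₁ < z.2 - xp},
          ENNReal.ofReal (2⁻¹ * (|V' z.2| * ψ z.1 z.2 ^ 2)))
        + ∫⁻ z in {z : ℝ × ℝ | t₁ < z.1 ∧ z.1 - t₁ < -(z.2 - xp)},
          ENNReal.ofReal (2⁻¹ * (|V' z.2| * ψ z.1 z.2 ^ 2)) := by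
    have hset : {z : ℝ × ℝ | t₁ < z.1 ∧ z.1 - t₁ < |z.2 - xp|}
        = {z : ℝ × ℝ | t₁ < z.1 ∧ z.1 - t₁ < z.2 - xp}
          ∪ {z : ℝ × ℝ | t₁ < z.1 ∧ z.1 - t₁ < -(z.2 - xp)} := by
      ext z
      simp only [mem_setOf_eq, mem_union, lt_abs]
      tauto
    have hm : MeasurableSet {z : ℝ × ℝ | t₁ < z.1 ∧ z.1 - t₁ < -(z.2 - xp)} := by
      have ha : Measurable fun z : ℝ × ℝ => z.1 - t₁ := by fun_prop
      have hb : Measurable fun z : ℝ × ℝ => -(z.2 - xp) := by fun_prop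
      exact (measurableSet_lt measurable_const measurable_fst).inter (measurableSet_lt ha hb)
    have hdisj : Disjoint {z : ℝ × ℝ | t₁ < z.1 ∧ z.1 - t₁ < z.2 - xp}
        {z : ℝ × ℝ | t₁ < z.1 ∧ z.1 - t₁ < -(z.2 - xp)} := by
      rw [Set.disjoint_left]
      rintro z ⟨h1, h2⟩ ⟨-, h3⟩
      linarith
    rw [hset, lintegral_union hm hdisj]
  rw [hKsplit, hBsplit, add_add_add_comm]
  exact add_le_add hR hL

end Summit.FinalStateConjecture.FinalStateConjecture.Theorems.WindowedShellChannelsSketch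

end
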